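import Summits.AtomisticToContinuum.HydrodynamicLimit.Theorems.CollisionIsometryCLTMacroClosureStubBlockMGFKinetic
import HarnessLib

/-!
# Stub `stub_blockMGF` of the line `IdeatorTwoGen1Sketch` (crux `MacroClosure`, stmt-14870), part 3:
# effective degrees of freedom and the Chernoff small-ball bound for cold blocks
# (registered sub-goal `stub_blockMGF_coldBlock`)

Proof file (`--supports stmt-AtomisticToContinuum-14870`) for the registered sub-goal
`stub_blockMGF_coldBlock` of `Barycentric.stub_blockMGF : HomogeneousBlockMGF`. From the weighted
Helmert–Chernoff bound of part 2 (`lintegral_exp_neg_wss_le`), for weights normalised by their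
maximum (`0 ≤ wᵢ ≤ 1`):

* Bernoulli's inequality `(1 + 2λ)^a ≤ 1 + 2λa` (`0 ≤ a ≤ 1`) on each Helmert coefficient
  `aₖ = wₖS_{>k}/S_{≥k} = wₖ − wₖ²/S_{≥k} ∈ [0, wₖ]` gives the `χ²`-DOMINATION IN THE LAPLACE ORDER
  `E exp(−(λ/θ)Q_w) ≤ (1 + 2λ)^{−(3/2)(W − D)}`, `W = Σwᵢ`, `D = Σₖ wₖ²/S_{≥k}`
  (`lintegral_exp_neg_wss_le_rpow`): the weighted sum of squares about the weighted mean
  `Q_w = 3Wθ̄` of `n` i.i.d. `N(u, θ id)` velocities dominates `θ χ²_{3(W−D)}`; for unit weights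
  `D = Σ 1/(n−k) ≤ 1 + log n`, i.e. `3(n − 1 − log n)` effective degrees of freedom out of the
  `3(n−1)` of Cochran's theorem;
* the exponential Chebyshev inequality at `1 + 2λ = 1/s` then yields the COLD-BLOCK BOUND with the
  sharp `χ²` rate function `I(s) = (s − 1 − log s)/2`:
  `P(Q_w ≤ 3sθ(W − D)) ≤ exp(−(3/2)(W − D)(s − 1 − log s))` for `0 < s ≤ 1`
  (`measure_wss_le_exp`), i.e. in block variables `P(θ̄ ≤ s θ (1 − D/W)) ≤ e^{−3(W−D) I(s)}`.

This is the estimate that prices cold blocks in `HomogeneousBlockMGF`: a block of `n` comparable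
weights at temperature `θ̄ ≤ sθ_c` costs `e^{−3(n − O(log n)) I(s)}`, against the gain
`e^{(3/2)γ' n (log(1/s) + O(1))}` of the sub-unit tilt, integrable in `s ↓ 0` as soon as
`γ' n < n − O(log n)`, i.e. eventually in `N` on the band (where `n ≥ c₁(N+1)^{1−3γ}/C → ∞`).
-/

noncomputable section

open MeasureTheory Filter Set Topology InformationTheory ProbabilityTheory
open scoped ENNReal ContDiff InnerProductSpace

namespace Summit.AtomisticToContinuum.HydrodynamicLimit.Theorems.MacroClosureLine

open Literature.MathematicalPhysics.KineticTheory Literature.Analysis.FluidPDE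
open Literature.Analysis.FunctionSpaces

namespace Barycentric

/-! ## Helmert coefficients -/

/-- Suffix sums split off their first term: `S_{≥k} = wₖ + S_{>k}`. [folklore] -/
theorem suffix_ge_eq_add {n : ℕ} (w : Fin n → ℝ) (k : Fin n) :
    (∑ j, if k ≤ j then w j else 0) = w k + ∑ j, if k < j then w j else 0 := by
  have h : ∀ j, (if k ≤ j then w j else 0) = (if k = j then w j else 0) + (if k < j then w j else 0) := by
    intro j
    rcases lt_trichotomy k j with hkj | hkj | hkj
    · simp [hkj, hkj.le, hkj.ne]
    · simp [hkj]
    · simp [not_le.2 hkj, not_lt.2 hkj.le, hkj.ne']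
  rw [Finset.sum_congr rfl fun j _ => h j, Finset.sum_add_distrib, Finset.sum_ite_eq]
  simp

/-- The Helmert coefficient in closed form: `wₖS_{>k}/S_{≥k} = wₖ − wₖ²/S_{≥k}` for non-negative
weights (junk conventions included). [folklore] -/
theorem helmertCoeff_eq {n : ℕ} {w : Fin n → ℝ} (hw : ∀ i, 0 ≤ w i) (k : Fin n) :
    w k * (∑ j, if k < j then w j else 0) / (∑ j, if k ≤ j then w j else 0) =
      w k - w k ^ 2 / ∑ j, if k ≤ j then w j else 0 := by
  rw [suffix_ge_eq_add]
  set T : ℝ := ∑ j, if k < j then w j else 0 with hT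
  have hT0 : 0 ≤ T := Finset.sum_nonneg fun j _ => by
    split_ifs
    · exact hw j
    · exact le_rfl
  by_cases hS : w k + T = 0
  · have hk : w k = 0 := by linarith [hw k]
    rw [hS, hk]
    simp
  · field_simp
    ring

/-- The Helmert coefficient lies in `[0, wₖ]` for non-negative weights. [folklore] -/
theorem helmertCoeff_mem {n : ℕ} {w : Fin n → ℝ} (hw : ∀ i, 0 ≤ w i) (k : Fin n) :
    0 ≤ w k * (∑ j, if k < j then w j else 0) / (∑ j, if k ≤ j then w j else 0) ∧
      w k * (∑ j, if k < j then w j else 0) / (∑ j, if k ≤ j then w j else 0) ≤ w k := by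
  rw [suffix_ge_eq_add]
  set T : ℝ := ∑ j, if k < j then w j else 0 with hT
  have hT0 : 0 ≤ T := Finset.sum_nonneg fun j _ => by
    split_ifs
    · exact hw j
    · exact le_rfl
  refine ⟨div_nonneg (mul_nonneg (hw k) hT0) (add_nonneg (hw k) hT0), ?_⟩
  by_cases hS : w k + T = 0
  · rw [hS, div_zero]
    exact hw k
  · rw [div_le_iff₀ (lt_of_le_of_ne (add_nonneg (hw k) hT0) (Ne.symm hS))]
    nlinarith [hw k, hT0]

/-- **Bernoulli on one Helmert factor**: `(1 + 2λa)^{−3/2} ≤ (1 + 2λ)^{−(3/2)a}` for `λ ≥ 0`,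
`0 ≤ a ≤ 1`. [folklore] -/
theorem rpow_helmert_le {l a : ℝ} (hl : 0 ≤ l) (ha0 : 0 ≤ a) (ha1 : a ≤ 1) :
    (1 + 2 * l * a) ^ (-(3 : ℝ) / 2) ≤ (1 + 2 * l) ^ (-(3 : ℝ) / 2 * a) := by
  have hb : (1 + 2 * l) ^ a ≤ 1 + a * (2 * l) :=
    rpow_one_add_le_one_add_mul_self (by linarith) ha0 ha1
  have hpos : 0 < (1 + 2 * l) ^ a := Real.rpow_pos_of_pos (by linarith) _
  calc (1 + 2 * l * a) ^ (-(3 : ℝ) / 2) ≤ ((1 + 2 * l) ^ a) ^ (-(3 : ℝ) / 2) := by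
        refine Real.rpow_le_rpow_of_nonpos hpos ?_ (by norm_num)
        linarith
    _ = (1 + 2 * l) ^ (-(3 : ℝ) / 2 * a) := by
        rw [← Real.rpow_mul (by linarith)]
        congr 1
        ring

/-! ## `χ²`-domination in the Laplace order -/

/-- **Effective degrees of freedom.** For weights `0 ≤ wᵢ ≤ 1` on `n` particles with i.i.d.
velocities `N(u, θ id)` and every `λ ≥ 0`,
`E exp(−(λ/θ)Q_w) ≤ (1 + 2λ)^{−(3/2)(W − D)}`, `W = Σwᵢ`, `D = Σₖ wₖ²/S_{≥k}`: the weighted sum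
of squares about the weighted mean dominates `θ χ²_{3(W−D)}` in the Laplace order. [folklore] -/
theorem lintegral_exp_neg_wss_le_rpow (u : V3) {θ : ℝ} (hθ : 0 < θ) {l : ℝ} (hl : 0 ≤ l) {n : ℕ}
    (w : Fin n → ℝ) (hw0 : ∀ i, 0 ≤ w i) (hw1 : ∀ i, w i ≤ 1) :
    ∫⁻ v, ENNReal.ofReal (Real.exp (-(l / θ) *
        ((∑ i, w i * ‖v i‖ ^ 2) - ‖∑ i, w i • v i‖ ^ 2 / ∑ i, w i)))
      ∂(Measure.pi fun _ : Fin n => gaussMeasure u θ) ≤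
    ENNReal.ofReal ((1 + 2 * l) ^ (-(3 : ℝ) / 2 *
      ((∑ i, w i) - ∑ k, w k ^ 2 / ∑ j, if k ≤ j then w j else 0))) := by
  refine (lintegral_exp_neg_wss_le u hθ hl n w hw0).trans (ENNReal.ofReal_le_ofReal ?_)
  have hsum : (∑ i, w i) - ∑ k, w k ^ 2 / (∑ j, if k ≤ j then w j else 0) =
      ∑ k, w k * (∑ j, if k < j then w j else 0) / ∑ j, if k ≤ j then w j else 0 := by
    rw [← Finset.sum_sub_distrib]
    exact Finset.sum_congr rfl fun k _ => (helmertCoeff_eq hw0 k).symm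
  rw [hsum, Finset.mul_sum, Real.rpow_sum_of_pos (by linarith)]
  refine Finset.prod_le_prod (fun k _ => Real.rpow_nonneg ?_ _) fun k _ => ?_
  · obtain ⟨h0, _⟩ := helmertCoeff_mem hw0 k
    have h2 : 0 ≤ 2 * l * (w k * (∑ j, if k < j then w j else 0) / ∑ j, if k ≤ j then w j else 0) :=
      mul_nonneg (mul_nonneg zero_le_two hl) h0
    linarith
  · obtain ⟨h0, h1⟩ := helmertCoeff_mem hw0 k
    exact rpow_helmert_le hl h0 (h1.trans (hw1 k))

/-- The effective number of degrees of freedom is non-negative: `D ≤ W`. [folklore] -/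
theorem deficiency_le {n : ℕ} {w : Fin n → ℝ} (hw0 : ∀ i, 0 ≤ w i) :
    0 ≤ (∑ i, w i) - ∑ k, w k ^ 2 / ∑ j, if k ≤ j then w j else 0 := by
  rw [← Finset.sum_sub_distrib]
  refine Finset.sum_nonneg fun k _ => ?_
  rw [← helmertCoeff_eq hw0 k]
  exact (helmertCoeff_mem hw0 k).1

/-! ## The Chernoff small-ball bound -/

/-- The Chernoff exponent algebra at `1 + 2λ = 1/s`:
`(1/s)^{−(3/2)m} / exp(−(3/2)m(1 − s)) = exp(−(3/2)m(s − 1 − log s))`. [folklore] -/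
theorem chernoff_algebra {s : ℝ} (hs : 0 < s) (m : ℝ) :
    (1 + 2 * ((s⁻¹ - 1) / 2)) ^ (-(3 : ℝ) / 2 * m) / Real.exp (-(3 / 2 * m * (1 - s))) =
      Real.exp (-(3 / 2 * m * (s - 1 - Real.log s))) := by
  have h1 : 1 + 2 * ((s⁻¹ - 1) / 2) = s⁻¹ := by ring
  rw [h1, Real.rpow_def_of_pos (inv_pos.2 hs), Real.log_inv, ← Real.exp_sub]
  congr 1
  ring

/-- **Chernoff small-ball bound for cold blocks.** For weights `0 ≤ wᵢ ≤ 1` on `n` particles with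
i.i.d. velocities `N(u, θ id)`, `θ > 0`, and `0 < s ≤ 1`:
`P(Q_w ≤ 3sθ(W − D)) ≤ exp(−(3/2)(W − D)(s − 1 − log s))` — the weighted sum of squares about
the weighted mean (`= 3Wθ̄`) is small only at the price of the `χ²_{3(W−D)}` rate function.
[folklore] -/
theorem measure_wss_le_exp (u : V3) {θ : ℝ} (hθ : 0 < θ) {n : ℕ} (w : Fin n → ℝ)
    (hw0 : ∀ i, 0 ≤ w i) (hw1 : ∀ i, w i ≤ 1) {s : ℝ} (hs0 : 0 < s) (hs1 : s ≤ 1) :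
    (Measure.pi fun _ : Fin n => gaussMeasure u θ)
        {v | (∑ i, w i * ‖v i‖ ^ 2) - ‖∑ i, w i • v i‖ ^ 2 / (∑ i, w i) ≤
          3 * s * θ * ((∑ i, w i) - ∑ k, w k ^ 2 / ∑ j, if k ≤ j then w j else 0)} ≤
      ENNReal.ofReal (Real.exp (-(3 / 2 *
        ((∑ i, w i) - ∑ k, w k ^ 2 / ∑ j, if k ≤ j then w j else 0) * (s - 1 - Real.log s)))) := by
  set m : ℝ := (∑ i, w i) - ∑ k, w k ^ 2 / ∑ j, if k ≤ j then w j else 0 with hm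
  set μ : Measure (Fin n → V3) := Measure.pi fun _ : Fin n => gaussMeasure u θ with hμ
  set l : ℝ := (s⁻¹ - 1) / 2 with hl
  have hl0 : 0 ≤ l := by
    rw [hl]
    have : 1 ≤ s⁻¹ := one_le_inv_iff₀.2 ⟨hs0, hs1⟩
    linarith
  set f : (Fin n → V3) → ℝ≥0∞ := fun v => ENNReal.ofReal (Real.exp (-(l / θ) *
      ((∑ i, w i * ‖v i‖ ^ 2) - ‖∑ i, w i • v i‖ ^ 2 / ∑ i, w i))) with hf
  have hfm : Measurable f := by
    have hc : Continuous fun v : Fin n → V3 => Real.exp (-(l / θ) *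
        ((∑ i, w i * ‖v i‖ ^ 2) - ‖∑ i, w i • v i‖ ^ 2 / ∑ i, w i)) := by
      fun_prop
    exact ENNReal.measurable_ofReal.comp hc.measurable
  set ε : ℝ≥0∞ := ENNReal.ofReal (Real.exp (-(l / θ) * (3 * s * θ * m))) with hε
  have hε0 : ε ≠ 0 := by
    rw [hε]
    exact (ENNReal.ofReal_pos.2 (Real.exp_pos _)).ne'
  have hεtop : ε ≠ ⊤ := ENNReal.ofReal_ne_top
  -- the event is contained in a super-level set of `f`
  have hsub : {v : Fin n → V3 | (∑ i, w i * ‖v i‖ ^ 2) - ‖∑ i, w i • v i‖ ^ 2 / (∑ i, w i) ≤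
      3 * s * θ * m} ⊆ {v | ε ≤ f v} := by
    intro v hv
    simp only [mem_setOf_eq] at hv ⊢
    rw [hε, hf]
    refine ENNReal.ofReal_le_ofReal (Real.exp_le_exp.2 ?_)
    exact mul_le_mul_of_nonpos_left hv (neg_nonpos.2 (div_nonneg hl0 hθ.le))
  -- Markov and the Laplace bound
  have hmarkov : ε * μ {v | ε ≤ f v} ≤ ∫⁻ v, f v ∂μ := mul_meas_ge_le_lintegral hfm ε
  have hlap : ∫⁻ v, f v ∂μ ≤ ENNReal.ofReal ((1 + 2 * l) ^ (-(3 : ℝ) / 2 * m)) :=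
    lintegral_exp_neg_wss_le_rpow u hθ hl0 w hw0 hw1
  calc μ {v | (∑ i, w i * ‖v i‖ ^ 2) - ‖∑ i, w i • v i‖ ^ 2 / (∑ i, w i) ≤ 3 * s * θ * m}
      ≤ μ {v | ε ≤ f v} := measure_mono hsub
    _ ≤ ENNReal.ofReal ((1 + 2 * l) ^ (-(3 : ℝ) / 2 * m)) / ε := by
        rw [ENNReal.le_div_iff_mul_le (Or.inl hε0) (Or.inl hεtop), mul_comm]
        exact hmarkov.trans hlap
    _ = ENNReal.ofReal (Real.exp (-(3 / 2 * m * (s - 1 - Real.log s)))) := by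
        rw [hε, ← ENNReal.ofReal_div_of_pos (Real.exp_pos _)]
        congr 1
        have e : -(l / θ) * (3 * s * θ * m) = -(3 / 2 * m * (1 - s)) := by
          rw [hl]
          field_simp
        rw [e, hl]
        exact chernoff_algebra hs0 m

/-- **`stub_blockMGF_coldBlock`** (registered sub-goal of `stub_blockMGF`): the cold-block bound
with the sharp `χ²` rate function — for block weights `0 ≤ wᵢ ≤ 1` (kernel values over the kernel
maximum), i.i.d. `N(u, θ id)` velocities and `0 < s ≤ 1`, the weighted sum of squares about the
weighted mean (`= 3Wθ̄`, `θ̄` the block temperature, `W = Σwᵢ`) satisfies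
`P(Q_w ≤ 3sθ(W − D)) ≤ exp(−(3/2)(W − D)(s − 1 − log s))`, `D = Σₖ wₖ²/Σ_{j ≥ k} wⱼ`
(`≤ 1 + log n` for unit weights). [folklore] -/
theorem stub_blockMGF_coldBlock : ∀ (n : ℕ) (w : Fin n → ℝ), (∀ i, 0 ≤ w i) → (∀ i, w i ≤ 1) → ∀ (u : V3) (θ : ℝ), 0 < θ → ∀ s : ℝ, 0 < s → s ≤ 1 → (Measure.pi fun _ : Fin n => gaussMeasure u θ) {v | (∑ i, w i * ‖v i‖ ^ 2) - ‖∑ i, w i • v i‖ ^ 2 / (∑ i, w i) ≤ 3 * s * θ * ((∑ i, w i) - ∑ k, w k ^ 2 / ∑ j, if k ≤ j then w j else 0)} ≤ ENNReal.ofReal (Real.exp (-(3 / 2 * ((∑ i, w i) - ∑ k, w k ^ 2 / ∑ j, if k ≤ j then w j else 0) * (s - 1 - Real.log s)))) :=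
  fun _ w hw0 hw1 u _ hθ _ hs0 hs1 => measure_wss_le_exp u hθ w hw0 hw1 hs0 hs1

end Barycentric

end Summit.AtomisticToContinuum.HydrodynamicLimit.Theorems.MacroClosureLine

end
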